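import Literature.Probability.Percolation.CerfUniquenessZoneBound
import HarnessLib

/-!
# `PercFiniteBoxLRO.Cerf2015BoxLRO16` (stmt-CriticalPhenomena-0860), tools III: inputs for Cerf's §9–§10
# for BOND percolation on `ℤ³` that need only the tree

Helper file (`--supports stmt-CriticalPhenomena-0860`) for the bond transcription of R. Cerf, Ann. Probab.
43 (2015), Theorem 1.3 (`d = 3`): monotonicity of the edge two-arms event in the scale (§9, "By
monotonicity"), `θ(p) ≤ P_p(0 ↔ ∂ⁱⁿΛ(m) in Λ(m))` (§10), the box two-arms sum at `θ(p) > 0`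
(`sum_real_twoArmsBox_le`: Cor. 7.2 with Lemma 7.1 and the two-point bound of Lemma 6.1, all from the
tree's bond toolbox `AKN.*`; `d = 3` polynomial form `sum_real_twoArmsBox_three_le`), the size bounds
`|E(Λ(m))| ≤ 6(2m+1)³`, `|∂ⁱⁿΛ(j)| ≤ 6(2j+1)²`, the boundary point `x_n` of §10
(`exists_boundary_point_theta`), and the elementary real / natural-number facts behind the dyadic
scales `n_s = (2·2^s+1) 2^{55 s} + 2^s` (`nseq_lt_succ`, `nseq_succ_le`, `exists_window`).
This file introduces no definition.

## References

* R. Cerf, *A lower bound on the two-arms exponent for critical percolation on the lattice*, Ann.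
  Probab. 43 (2015) 2458–2480, arXiv:1306.3105 [Cerf2015].
-/

noncomputable section

namespace Summit.CriticalPhenomena.PercolationContinuityZ3.Theorems

namespace Cerf2015BoxLRO16

open Literature.Probability.Percolation Literature.Probability.Percolation.AKN
  Literature.Probability.Percolation.GM Literature.Probability.LatticeModels MeasureTheory Finset Real
open scoped Classical

variable {d : ℕ}

/-- **`m ↦ two-arms(0, m)` is decreasing** (Cerf 2015, §9: "By monotonicity,
`P(two-arms(0,n)) ≤ P(two-arms(0,⌊n/3⌋))`"), bond version for the edge two-arms event, `1 ≤ m ≤ m'`.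
[cite: Cerf2015, §9] -/
theorem edgeTwoArms_anti (i : Fin d) {m m' : ℕ} (hm : 1 ≤ m) (hmm' : m ≤ m') :
    edgeTwoArms (d := d) i m' ⊆ edgeTwoArms i m := by
  rintro ω ⟨hne, hr0, hr1⟩
  have hsub : (↑(box d m) : Set (Site d)) ⊆ ↑(box d m') := Finset.coe_subset.2 (box_mono d hmm')
  have h0 : (0 : Site d) ∈ box d m := zero_mem_box d m
  have h1 : (Pi.single i 1 : Site d) ∈ box d m := by
    rw [mem_box]; intro j
    by_cases hji : j = i
    · subst hji; simp; omega
    · simp [Pi.single_eq_of_ne hji]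
  exact ⟨notMem_openClusterIn_mono hsub hne, reaches_mono_region (box_mono d hmm') h0 hr0,
    reaches_mono_region (box_mono d hmm') h1 hr1⟩

/-- Monotonicity of the edge two-arms probability: `P_p(edgeTwoArms i m') ≤ P_p(edgeTwoArms i m)` for
`1 ≤ m ≤ m'`. [cite: Cerf2015, §9] -/
theorem real_edgeTwoArms_anti (p : unitInterval) (i : Fin d) {m m' : ℕ} (hm : 1 ≤ m) (hmm' : m ≤ m') :
    (bondPercolation (zdGraph d) p).real (edgeTwoArms i m') ≤ (bondPercolation (zdGraph d) p).real (edgeTwoArms i m) :=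
  measureReal_mono (edgeTwoArms_anti i hm hmm') (measure_ne_top _ _)

/-- **`θ(p) ≤ P_p(0 ↔ ∂ⁱⁿΛ(m) in Λ(m))`** in the `Reaches` form (Cerf 2015, §10: "`θ(p) ≤ P(0 ↔ ∂ⁱⁿΛ(n))`";
an infinite cluster leaves every box). [cite: Cerf2015, §10] -/
theorem theta_le_real_reaches (p : unitInterval) (m : ℕ) :
    theta (zdGraph d) 0 p ≤ (bondPercolation (zdGraph d) p).real {ω | Reaches (zdGraph d) (box d m) ω 0} := by
  refine (DCT16.theta_le_real_siteToBoundary p m).trans ?_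
  refine DCT16.real_mono_of_forall_subset_edgeSet (zdGraph d) p fun ω hω h => ?_
  obtain ⟨y, hy, hy0⟩ := h
  refine ⟨y, hy, ?_⟩
  rw [openConnIn_eq_openConnVia (Finset.mem_coe.2 (zero_mem_box d m))] at hy0
  change y ∈ openClusterIn _ ω 0 at hy0
  rwa [← openClusterIn_withinGraph_eq_top (zdGraph d) _ hω] at hy0

/-- **The two-arms event of a box at `θ(p) > 0`** (Cerf 2015, Cor. 7.2 with Lemma 7.1 at `k = n` and the
connection lower bound of Lemma 6.1 in its `θ(p) > 0` form of §10, bond version): for `d ≥ 1`,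
`0 < p`, `k ≥ 1`, `ℓ ≥ k + 3`,
`Σ_{z,z' ∈ Λ(k)} P_p(twoArmsBox k ℓ z z') ≤ |Λ(k)|² (1 + |E(Λ(2k+1))|/p) |Λ(2k+1)| τ(ℓ−k−2) / q₀`,
`τ(m) = Σ_i P_p(edgeTwoArms i m)`, `q₀ = p^{d+2} (p (θ(p)/(2d(2k+1)^{d−1}))²)^d`.
[cite: Cerf2015, Cor 7.2 and §10] -/
theorem sum_real_twoArmsBox_le (hd : 1 ≤ d) (p : unitInterval) (hp0 : 0 < (p : ℝ))
    (hθ : 0 < theta (zdGraph d) 0 p) {k ℓ : ℕ} (hk : 1 ≤ k) (hℓ : k + 3 ≤ ℓ) :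
    ∑ z ∈ box d k, ∑ z' ∈ box d k, (bondPercolation (zdGraph d) p).real (twoArmsBox k ℓ z z') ≤
      ((box d k).card : ℝ) ^ 2 *
        ((1 + (edgesIn (zdGraph d) (box d (k + k + 1))).card / p) *
          ((box d (k + k + 1)).card * ∑ i : Fin d, (bondPercolation (zdGraph d) p).real (edgeTwoArms i (ℓ - k - 2)))) /
        ((p : ℝ) ^ (d + 2) * ((p : ℝ) * (theta (zdGraph d) 0 p / (2 * d * (2 * k + 1) ^ (d - 1))) ^ 2) ^ d) := by
  set μ := bondPercolation (zdGraph d) p with hμ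
  set θ := theta (zdGraph d) 0 p with hθdef
  obtain ⟨Rf, hRf⟩ : ∃ Rf : ℝ, Rf = (1 + (edgesIn (zdGraph d) (box d (k + k + 1))).card / p) *
      ((box d (k + k + 1)).card * ∑ i : Fin d, μ.real (edgeTwoArms i (ℓ - k - 2))) := ⟨_, rfl⟩
  rw [← hRf]
  obtain ⟨q₀, hq₀⟩ : ∃ q₀ : ℝ, q₀ = (p : ℝ) ^ (d + 2) * ((p : ℝ) * (θ / (2 * d * (2 * k + 1) ^ (d - 1))) ^ 2) ^ d :=
    ⟨_, rfl⟩
  rw [← hq₀]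
  have hθ1 : θ ≤ 1 := measureReal_le_one
  have hq₀0 : 0 < q₀ := by rw [hq₀]; positivity
  have hinput : ∀ m : ℕ, 1 ≤ m → m ≤ k → ∃ b ∈ innerBoundary (zdGraph d) (box d m),
      θ / (2 * d * (2 * m + 1) ^ (d - 1)) ≤ μ.real (bconn (box d m) 0 b) := by
    intro m hm _
    obtain ⟨b, hb, hbθ⟩ := exists_boundary_point hd p hm
    refine ⟨b, hb, le_trans ?_ hbθ⟩
    exact div_le_div_of_nonneg_right (theta_le_real_reaches p m) (by positivity)
  have hq : ∀ a ∈ box d k, ∀ b ∈ box d k, q₀ ≤ μ.real (bconn (box d (k + k)) a b) := by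
    intro a ha b hb
    have := bconn_two_point_lower p hθ.le hθ1 hinput ha hb
    rwa [two_mul k, ← hq₀] at this
  have hpair : ∀ a ∈ box d k, ∀ b ∈ box d k, μ.real (twoArmsBox k ℓ a b) ≤ Rf / q₀ := by
    intro a ha b hb
    have h71 := real_twoArmsBox_mul_le p hp0 (n := k) (k := k) hℓ ha hb
    rw [← hRf] at h71
    rw [le_div_iff₀ hq₀0]
    calc μ.real (twoArmsBox k ℓ a b) * q₀ ≤ μ.real (twoArmsBox k ℓ a b) *
          μ.real (openConnVia (withinGraph (zdGraph d) ↑(box d (k + k))) a b) :=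
          mul_le_mul_of_nonneg_left (hq a ha b hb) measureReal_nonneg
      _ ≤ Rf := h71
  calc ∑ z ∈ box d k, ∑ z' ∈ box d k, μ.real (twoArmsBox k ℓ z z')
      ≤ ∑ _z ∈ box d k, ∑ _z' ∈ box d k, Rf / q₀ :=
        Finset.sum_le_sum fun a ha => Finset.sum_le_sum fun b hb => hpair a ha b hb
    _ = ((box d k).card : ℝ) ^ 2 * Rf / q₀ := by
        rw [Finset.sum_const, Finset.sum_const, nsmul_eq_mul, nsmul_eq_mul]; ring

/-- `|E(Λ(m))| ≤ 6 (2m+1)³` on `ℤ³`. [folklore] -/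
theorem card_edgesIn_box_three_le (m : ℕ) : ((edgesIn (zdGraph 3) (box 3 m)).card : ℝ) ≤ 6 * (2 * (m : ℝ) + 1) ^ 3 := by
  have h := card_edgesIn_le (d := 3) (box 3 m)
  rw [card_box] at h
  have h' : ((edgesIn (zdGraph 3) (box 3 m)).card : ℝ) ≤ ((2 * 3 * (2 * m + 1) ^ 3 : ℕ) : ℝ) := by exact_mod_cast h
  refine h'.trans (le_of_eq ?_)
  push_cast; ring

/-- **The box two-arms sum on `ℤ³`, polynomial form**: for `0 < p`, `θ(p) > 0`, `k ≥ 1`, `ℓ ≥ k + 3`,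
`Σ_{z,z' ∈ Λ(k)} P_p(twoArmsBox k ℓ z z') ≤ (3^18 7^7 6^6/(p^9 θ(p)^6)) k^24 τ(ℓ−k−2)` (Cerf 2015, Cor. 7.2
with Lemma 6.1: order `n^{4d−2} · n^{2(d−1)d} = n^{22}` for `d = 3`; here cruder). [cite: Cerf2015, Cor 7.2] -/
theorem sum_real_twoArmsBox_three_le (p : unitInterval) (hp0 : 0 < (p : ℝ))
    (hθ : 0 < theta (zdGraph 3) 0 p) {k ℓ : ℕ} (hk : 1 ≤ k) (hℓ : k + 3 ≤ ℓ) :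
    ∑ z ∈ box 3 k, ∑ z' ∈ box 3 k, (bondPercolation (zdGraph 3) p).real (twoArmsBox k ℓ z z') ≤
      (3 : ℝ) ^ 18 * 7 ^ 7 * 6 ^ 6 / ((p : ℝ) ^ 9 * theta (zdGraph 3) 0 p ^ 6) * (k : ℝ) ^ 24 *
        ∑ i : Fin 3, (bondPercolation (zdGraph 3) p).real (edgeTwoArms i (ℓ - k - 2)) := by
  obtain ⟨θ, hθdef⟩ : ∃ θ' : ℝ, θ' = theta (zdGraph 3) 0 p := ⟨_, rfl⟩
  have hθ0 : 0 < θ := by rw [hθdef]; exact hθ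
  obtain ⟨T, hT⟩ : ∃ T : ℝ, T = ∑ i : Fin 3, (bondPercolation (zdGraph 3) p).real (edgeTwoArms i (ℓ - k - 2)) := ⟨_, rfl⟩
  have hT0 : 0 ≤ T := by rw [hT]; exact Finset.sum_nonneg fun _ _ => measureReal_nonneg
  have h3 := sum_real_twoArmsBox_le (d := 3) (by norm_num) p hp0 hθ hk hℓ
  rw [← hT, ← hθdef] at h3 ⊢
  have hk0 : (0 : ℝ) < k := by exact_mod_cast hk
  have hk1 : (1 : ℝ) ≤ k := by exact_mod_cast hk
  have hp1 : (p : ℝ) ≤ 1 := p.2.2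
  have h23 : (2 * (k : ℝ) + 1) ≤ 3 * (k : ℝ) := by linarith
  -- the three factors
  have ha : ((box 3 k).card : ℝ) ^ 2 ≤ 729 * (k : ℝ) ^ 6 := by
    rw [card_box]; push_cast
    calc ((2 * (k : ℝ) + 1) ^ 3) ^ 2 = (2 * (k : ℝ) + 1) ^ 6 := by ring
      _ ≤ (3 * (k : ℝ)) ^ 6 := pow_le_pow_left₀ (by linarith) h23 6
      _ = 729 * (k : ℝ) ^ 6 := by ring
  have hE2 := card_edgesIn_box_three_le (k + k + 1)
  push_cast at hE2
  have hY : (2 * ((k : ℝ) + k + 1) + 1) ≤ 7 * (k : ℝ) := by linarith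
  have hY3 : (2 * ((k : ℝ) + k + 1) + 1) ^ 3 ≤ (7 * (k : ℝ)) ^ 3 := pow_le_pow_left₀ (by linarith) hY 3
  have h7k : (1 : ℝ) ≤ (7 * (k : ℝ)) ^ 3 := one_le_pow₀ (by linarith)
  have hb : (1 + ((edgesIn (zdGraph 3) (box 3 (k + k + 1))).card : ℝ) / (p : ℝ)) * ((box 3 (k + k + 1)).card : ℝ) ≤
      7 ^ 7 * (k : ℝ) ^ 6 / p := by
    rw [card_box]
    push_cast
    have h1 : 1 + ((edgesIn (zdGraph 3) (box 3 (k + k + 1))).card : ℝ) / p ≤ 7 * (7 * (k : ℝ)) ^ 3 / p := by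
      rw [add_div' _ _ _ hp0.ne', div_le_div_iff_of_pos_right hp0]
      nlinarith
    calc (1 + ((edgesIn (zdGraph 3) (box 3 (k + k + 1))).card : ℝ) / p) * (2 * ((k : ℝ) + k + 1) + 1) ^ 3
        ≤ (7 * (7 * (k : ℝ)) ^ 3 / p) * (7 * (k : ℝ)) ^ 3 :=
          mul_le_mul h1 hY3 (pow_nonneg (by linarith) 3) (div_nonneg (by positivity) hp0.le)
      _ = 7 ^ 7 * (k : ℝ) ^ 6 / p := by ring
  have hc : (2 * (k : ℝ) + 1) ^ 12 ≤ 3 ^ 12 * (k : ℝ) ^ 12 := by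
    calc (2 * (k : ℝ) + 1) ^ 12 ≤ (3 * (k : ℝ)) ^ 12 := pow_le_pow_left₀ (by linarith) h23 12
      _ = 3 ^ 12 * (k : ℝ) ^ 12 := by ring
  have hk21 : (2 * (k : ℝ) + 1) ≠ 0 := by positivity
  have heq : (p : ℝ) ^ (3 + 2) * ((p : ℝ) * (θ / (2 * ((3 : ℕ) : ℝ) * (2 * (k : ℝ) + 1) ^ (3 - 1))) ^ 2) ^ 3 =
      (p : ℝ) ^ 8 * θ ^ 6 / (6 ^ 6 * (2 * (k : ℝ) + 1) ^ 12) := by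
    push_cast
    field_simp
    ring
  have hq : (p : ℝ) ^ 8 * θ ^ 6 / (6 ^ 6 * (3 ^ 12 * (k : ℝ) ^ 12)) ≤
      (p : ℝ) ^ (3 + 2) * ((p : ℝ) * (θ / (2 * ((3 : ℕ) : ℝ) * (2 * (k : ℝ) + 1) ^ (3 - 1))) ^ 2) ^ 3 := by
    rw [heq]
    exact div_le_div_of_nonneg_left (by positivity) (by positivity) (mul_le_mul_of_nonneg_left hc (by norm_num))
  have hqpos : 0 < (p : ℝ) ^ 8 * θ ^ 6 / (6 ^ 6 * (3 ^ 12 * (k : ℝ) ^ 12)) := by positivity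
  have hnum0 : 0 ≤ (729 * (k : ℝ) ^ 6) * (7 ^ 7 * (k : ℝ) ^ 6 / p * T) :=
    mul_nonneg (by positivity) (mul_nonneg (div_nonneg (by positivity) hp0.le) hT0)
  have hnum : ((box 3 k).card : ℝ) ^ 2 *
      ((1 + ((edgesIn (zdGraph 3) (box 3 (k + k + 1))).card : ℝ) / (p : ℝ)) * (((box 3 (k + k + 1)).card : ℝ) * T)) ≤
      (729 * (k : ℝ) ^ 6) * (7 ^ 7 * (k : ℝ) ^ 6 / p * T) := by
    have hmid : (1 + ((edgesIn (zdGraph 3) (box 3 (k + k + 1))).card : ℝ) / (p : ℝ)) * (((box 3 (k + k + 1)).card : ℝ) * T) ≤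
        7 ^ 7 * (k : ℝ) ^ 6 / p * T := by
      rw [← mul_assoc]
      exact mul_le_mul_of_nonneg_right hb hT0
    have hmid0 : 0 ≤ (1 + ((edgesIn (zdGraph 3) (box 3 (k + k + 1))).card : ℝ) / (p : ℝ)) * (((box 3 (k + k + 1)).card : ℝ) * T) :=
      mul_nonneg (add_nonneg zero_le_one (div_nonneg (Nat.cast_nonneg _) hp0.le)) (mul_nonneg (Nat.cast_nonneg _) hT0)
    exact mul_le_mul ha hmid hmid0 (by positivity)
  calc _ ≤ _ := h3
    _ ≤ (729 * (k : ℝ) ^ 6) * (7 ^ 7 * (k : ℝ) ^ 6 / p * T) / ((p : ℝ) ^ 8 * θ ^ 6 / (6 ^ 6 * (3 ^ 12 * (k : ℝ) ^ 12))) :=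
        div_le_div₀ hnum0 hnum hqpos hq
    _ = (3 : ℝ) ^ 18 * 7 ^ 7 * 6 ^ 6 / ((p : ℝ) ^ 9 * θ ^ 6) * (k : ℝ) ^ 24 * T := by
        field_simp
        ring

/-- `|∂ⁱⁿΛ(j)| ≤ 6(2j+1)²` on `ℤ³`. [folklore] -/
theorem card_innerBoundary_box_three_le (j : ℕ) :
    ((innerBoundary (zdGraph 3) (box 3 j)).card : ℝ) ≤ 6 * (2 * (j : ℝ) + 1) ^ 2 := by
  have h := card_innerBoundary_box_le (d := 3) j
  have h' : ((innerBoundary (zdGraph 3) (box 3 j)).card : ℝ) ≤ ((2 * 3 * (2 * j + 1) ^ (3 - 1) : ℕ) : ℝ) := by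
    exact_mod_cast h
  refine h'.trans (le_of_eq ?_)
  push_cast; ring

/-- **The boundary point `x_n`** (Cerf 2015, §10: "there exists `x_n` in `∂ⁱⁿΛ(n)` such that
`P(0 ↔ x_n in Λ(n)) ≥ θ(p)/|∂ⁱⁿΛ(n)| ≥ θ(p)/(2d(2n+1)^{d−1})`"), bond version on `ℤ³`.
[cite: Cerf2015, §10] -/
theorem exists_boundary_point_theta (p : unitInterval) {n : ℕ} (hn : 1 ≤ n) :
    ∃ b ∈ innerBoundary (zdGraph 3) (box 3 n),
      theta (zdGraph 3) 0 p / (6 * (2 * (n : ℝ) + 1) ^ 2) ≤ (bondPercolation (zdGraph 3) p).real (bconn (box 3 n) 0 b) := by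
  obtain ⟨b, hb, hbθ⟩ := exists_boundary_point (d := 3) (by norm_num) p hn
  refine ⟨b, hb, le_trans ?_ hbθ⟩
  have h := div_le_div_of_nonneg_right (theta_le_real_reaches (d := 3) p n) (by positivity : (0 : ℝ) ≤ 2 * (3 : ℕ) * (2 * n + 1) ^ (3 - 1))
  refine le_trans (le_of_eq ?_) h
  push_cast; ring

/-- `log 2 ≤ 1` (from `log x ≤ x − 1`). [folklore] -/
theorem log_two_le_one : Real.log 2 ≤ 1 := by
  have := Real.log_le_sub_one_of_pos (zero_lt_two' ℝ); linarith

/-- `s + 1 ≤ 2^s` in `ℝ`. [folklore] -/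
theorem succ_le_two_pow_real (s : ℕ) : (s : ℝ) + 1 ≤ (2 : ℝ) ^ s := by
  have h : s + 1 ≤ 2 ^ s := Nat.lt_two_pow_self
  exact_mod_cast h

/-- `(√2)^s (√2)^s = 2^s`. [folklore] -/
theorem sqrt_two_pow_mul_self (s : ℕ) : Real.sqrt 2 ^ s * Real.sqrt 2 ^ s = (2 : ℝ) ^ s := by
  rw [← mul_pow, Real.mul_self_sqrt zero_le_two]

/-- The dyadic scales `n_s = (2·2^s+1) 2^{55 s} + 2^s` increase. [folklore] -/
theorem nseq_lt_succ (s : ℕ) :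
    (2 * 2 ^ s + 1) * 2 ^ (55 * s) + 2 ^ s < (2 * 2 ^ (s + 1) + 1) * 2 ^ (55 * (s + 1)) + 2 ^ (s + 1) := by
  have hJ : 2 ^ (55 * (s + 1)) = 2 ^ (55 * s) * 2 ^ 55 := by rw [← pow_add, Nat.mul_succ]
  have hK : 2 ^ (s + 1) = 2 ^ s * 2 := pow_succ 2 s
  rw [hJ, hK]
  have h2 : 1 ≤ 2 ^ s := Nat.one_le_two_pow
  have h3 : (1 : ℕ) ≤ 2 ^ 55 := Nat.one_le_two_pow
  nlinarith [Nat.mul_le_mul_left (2 ^ s * 2 ^ (55 * s)) h3, Nat.mul_le_mul_left (2 ^ (55 * s)) h3]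

/-- Consecutive dyadic scales differ by a factor at most `2^57`. [folklore] -/
theorem nseq_succ_le (s : ℕ) :
    (2 * 2 ^ (s + 1) + 1) * 2 ^ (55 * (s + 1)) + 2 ^ (s + 1) ≤ 2 ^ 57 * ((2 * 2 ^ s + 1) * 2 ^ (55 * s) + 2 ^ s) := by
  have hJ : 2 ^ (55 * (s + 1)) = 2 ^ (55 * s) * 2 ^ 55 := by rw [← pow_add, Nat.mul_succ]
  have hK : 2 ^ (s + 1) = 2 ^ s * 2 := pow_succ 2 s
  have h57 : (2 : ℕ) ^ 57 = 2 ^ 55 * 4 := by norm_num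
  rw [hJ, hK, h57]
  have h3 : (1 : ℕ) ≤ 2 ^ 55 := Nat.one_le_two_pow
  nlinarith [Nat.zero_le (2 ^ (55 * s) * 2 ^ 55 * 2 ^ s), Nat.zero_le (2 ^ (55 * s) * 2 ^ 55),
    Nat.mul_le_mul_right (2 ^ s) h3]

/-- Every `m ≥ 3 n_{s₀}` lies in a window `[3 n_s, 3 n_{s+1}]` with `s ≥ s₀`. [folklore] -/
theorem exists_window {s₀ m : ℕ} (hm : 3 * ((2 * 2 ^ s₀ + 1) * 2 ^ (55 * s₀) + 2 ^ s₀) ≤ m) :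
    ∃ s, s₀ ≤ s ∧ 3 * ((2 * 2 ^ s + 1) * 2 ^ (55 * s) + 2 ^ s) ≤ m ∧
      m ≤ 3 * ((2 * 2 ^ (s + 1) + 1) * 2 ^ (55 * (s + 1)) + 2 ^ (s + 1)) := by
  induction m, hm using Nat.le_induction with
  | base => exact ⟨s₀, le_rfl, le_rfl, Nat.mul_le_mul_left 3 (nseq_lt_succ s₀).le⟩
  | succ m _ ih =>
    obtain ⟨s, hs₀, h1, h2⟩ := ih
    by_cases h : m + 1 ≤ 3 * ((2 * 2 ^ (s + 1) + 1) * 2 ^ (55 * (s + 1)) + 2 ^ (s + 1))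
    · exact ⟨s, hs₀, h1.trans (Nat.le_succ m), h⟩
    · refine ⟨s + 1, hs₀.trans (Nat.le_succ s), by omega, ?_⟩
      have := nseq_lt_succ (s + 1)
      omega

end Cerf2015BoxLRO16

end Summit.CriticalPhenomena.PercolationContinuityZ3.Theorems

end
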